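import Mathlib
import Literature.Analysis.Calculus.RadialHardyTwoEdge
import Literature.Analysis.ODE.InverseSquareTailOperator
import Summits.FinalStateConjecture.FinalStateConjecture.Theorems.PhotonSphereChannelsUniformPhotonSphereChannelsRPeelHardy

/-!
# Peeling, file 1b: two Hardy inequalities on a half-line

Support file for `stub_peel` of the line `crum-peeling-recessive-tower` (crux
`UniformPhotonSphereChannelsR`, stmt-FinalStateConjecture-14074), `X > 0` throughout:

* `hardy_primitive` — `∫_X^∞ (∫_X^x |g|)²/x² ≤ 4 ∫_X^∞ g²` (Hardy for primitives vanishing at the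
  finite edge, from `Literature.Analysis.Calculus.hardy_sq_interval_le` on `[X, Y]`, `Y → ∞`);
* `hardy_tail_pointwise`, `hardy_tail` — for `Φ(x) = ∫_x^∞ y^{-3/4}|f(y)| dy`:
  `Φ(x)² ≤ 2 x^{-1/2} ‖f‖²_{L²(x,∞)}` and `∫_X^∞ x^{-1/2} Φ² ≤ 16 ∫_X^∞ f²` (the dual Hardy
  inequality; the weight `y^{-3/4}` is the decay rate available for every recessive Darboux seed
  of the peeling, whose logarithmic derivative `W` has `x W(x) → −λ ≤ −1`).
-/

noncomputable section

-- the doubled `FinalStateConjecture` component is the tree's fixed summit/problem path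
set_option linter.dupNamespace false

namespace Summit.FinalStateConjecture.FinalStateConjecture.Theorems.CrumPeelingRecessiveTower

open MeasureTheory Set Filter Topology intervalIntegral

/-! ### Hardy's inequality for primitives vanishing at the edge -/

/-- **Hardy inequality for a primitive.** For `X > 0`, `g` continuous on `[X, ∞)` with
`g ∈ L²(X, ∞)`, the primitive `F(x) = ∫_X^x |g|` (of the clamped integrand, so that `F` is
differentiable on `ℝ`) satisfies `F²/x² ∈ L¹(X, ∞)` and `∫_{(X,∞)} F²/x² ≤ 4 ∫_{(X,∞)} g²`. -/
theorem hardy_primitive {g : ℝ → ℝ} {X : ℝ} (hX : 0 < X) (hg : ContinuousOn g (Ici X))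
    (hg2 : IntegrableOn (fun x => g x ^ 2) (Ioi X)) :
    IntegrableOn (fun x => (∫ y in X..x, |g (max y X)|) ^ 2 / x ^ 2) (Ioi X) ∧
      ∫ x in Ioi X, (∫ y in X..x, |g (max y X)|) ^ 2 / x ^ 2 ≤ 4 * ∫ x in Ioi X, g x ^ 2 := by
  set G : ℝ → ℝ := fun y => |g (max y X)| with hG
  have hGc : Continuous G :=
    (Literature.Analysis.ODE.continuous_comp_max_of_continuousOn hg).abs
  set F : ℝ → ℝ := fun x => ∫ y in X..x, G y with hF
  have hFd : ∀ x, HasDerivAt F (G x) x := fun x =>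
    intervalIntegral.integral_hasDerivAt_right (hGc.intervalIntegrable _ _)
      (hGc.stronglyMeasurableAtFilter _ _) hGc.continuousAt
  have hFc : Continuous F := continuous_iff_continuousAt.2 fun x => (hFd x).continuousAt
  have hF0 : F X = 0 := intervalIntegral.integral_same
  -- the interval inequality
  have hint : ∀ Y, X ≤ Y → ∫ x in X..Y, F x ^ 2 / x ^ 2 ≤ 4 * ∫ x in Ioi X, g x ^ 2 := by
    intro Y hY
    have h := Literature.Analysis.Calculus.hardy_sq_interval_le hX hY (fun r _ => hFd r)
      hGc.continuousOn
    rw [hF0] at h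
    simp only [ne_eq, OfNat.ofNat_ne_zero, not_false_eq_true, zero_pow, zero_div, zero_add] at h
    have hG2 : ∫ x in X..Y, G x ^ 2 = ∫ x in X..Y, g x ^ 2 := by
      refine intervalIntegral.integral_congr fun x hx => ?_
      rw [uIcc_of_le hY] at hx
      simp only [hG, max_eq_left hx.1, sq_abs]
    have hle : ∫ x in X..Y, g x ^ 2 ≤ ∫ x in Ioi X, g x ^ 2 := by
      rw [intervalIntegral.integral_of_le hY]
      exact setIntegral_mono_set hg2 (ae_of_all _ fun x => sq_nonneg _)
        (ae_of_all _ Ioc_subset_Ioi_self)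
    have hpos : 0 ≤ F Y ^ 2 / Y := div_nonneg (sq_nonneg _) (hX.le.trans hY)
    rw [hG2] at h
    linarith
  have hcont : ContinuousOn (fun x => F x ^ 2 / x ^ 2) (Ici X) := by
    refine ContinuousOn.div (by fun_prop) (by fun_prop) fun x hx => ?_
    exact pow_ne_zero _ (hX.trans_le hx).ne'
  have hnn : ∀ x, 0 ≤ F x ^ 2 / x ^ 2 := fun x => div_nonneg (sq_nonneg _) (sq_nonneg _)
  have hI : IntegrableOn (fun x => F x ^ 2 / x ^ 2) (Ioi X) := by
    refine integrableOn_Ioi_of_intervalIntegral_norm_bounded (4 * ∫ x in Ioi X, g x ^ 2) X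
      (l := atTop) (b := id) (fun Y => ?_) tendsto_id ?_
    · exact ((hcont.mono Icc_subset_Ici_self).integrableOn_compact isCompact_Icc).mono_set
        Ioc_subset_Icc_self
    · filter_upwards [Filter.eventually_ge_atTop X] with Y hY
      have : ∫ x in X..id Y, ‖F x ^ 2 / x ^ 2‖ = ∫ x in X..Y, F x ^ 2 / x ^ 2 :=
        intervalIntegral.integral_congr fun x _ => by
          rw [Real.norm_eq_abs, abs_of_nonneg (hnn x)]
      rw [this]
      exact hint Y hY
  refine ⟨hI, ?_⟩
  have hlim := intervalIntegral_tendsto_integral_Ioi X hI tendsto_id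
  refine le_of_tendsto hlim ?_
  filter_upwards [Filter.eventually_ge_atTop X] with Y hY
  exact hint Y hY

/-! ### The dual Hardy inequality for tails with the weight `y^{-3/4}` -/

/-- Exponent bookkeeping: `x^{1/2} x^{-3/4} = x^{-1/4}` for `x > 0`. -/
theorem rpow_half_mul_rpow_neg_three_quarters {x : ℝ} (hx : 0 < x) :
    x ^ ((1 : ℝ) / 2) * x ^ (-(3 : ℝ) / 4) = x ^ (-(1 : ℝ) / 4) := by
  rw [← Real.rpow_add hx]; norm_num

/-- Exponent bookkeeping: `(x^{-1/4})² = x^{-1/2}` for `x > 0`. -/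
theorem rpow_neg_quarter_sq {x : ℝ} (hx : 0 < x) :
    (x ^ (-(1 : ℝ) / 4)) ^ 2 = x ^ (-(1 : ℝ) / 2) := by
  rw [← Real.rpow_natCast, ← Real.rpow_mul hx.le]; norm_num

/-- Exponent bookkeeping: `(x^{-3/4})² = x^{-3/2}` for `x > 0`. -/
theorem rpow_neg_three_quarters_sq {x : ℝ} (hx : 0 < x) :
    (x ^ (-(3 : ℝ) / 4)) ^ 2 = x ^ (-(3 : ℝ) / 2) := by
  rw [← Real.rpow_natCast, ← Real.rpow_mul hx.le]; norm_num

/-- Exponent bookkeeping: `x^{1/2} x^{-1/2} = 1` for `x > 0`. -/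
theorem rpow_half_mul_rpow_neg_half {x : ℝ} (hx : 0 < x) :
    x ^ ((1 : ℝ) / 2) * x ^ (-(1 : ℝ) / 2) = 1 := by
  rw [← Real.rpow_add hx]; norm_num

/-- **Dual Hardy inequality (tail form), part 1.**  For `X > 0`, `f` continuous on `[X, ∞)` with
`f ∈ L²(X, ∞)`: the weighted tail `Φ(x) = ∫_{(x,∞)} y^{-3/4} |f(y)| dy` is well defined
(`y^{-3/4}|f| ∈ L¹(X, ∞)`) and `Φ(x)² ≤ 2 x^{-1/2} ∫_{(x,∞)} f²` for `x ≥ X` (Cauchy–Schwarz). -/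
theorem hardy_tail_pointwise {f : ℝ → ℝ} {X : ℝ} (hX : 0 < X) (hf : ContinuousOn f (Ici X))
    (hf2 : IntegrableOn (fun x => f x ^ 2) (Ioi X)) :
    IntegrableOn (fun y => y ^ (-(3 : ℝ) / 4) * |f y|) (Ioi X) ∧
      ∀ x, X ≤ x → (∫ y in Ioi x, y ^ (-(3 : ℝ) / 4) * |f y|) ^ 2
        ≤ 2 * x ^ (-(1 : ℝ) / 2) * ∫ y in Ioi x, f y ^ 2 := by
  have hρc : ContinuousOn (fun y : ℝ => y ^ (-(3 : ℝ) / 4)) (Ici X) := fun y hy =>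
    (Real.continuousAt_rpow_const _ _ (Or.inl (hX.trans_le hy).ne')).continuousWithinAt
  have key : ∀ x, X ≤ x →
      IntegrableOn (fun y => y ^ (-(3 : ℝ) / 4) * |f y|) (Ioi x) ∧
      (∫ y in Ioi x, y ^ (-(3 : ℝ) / 4) * |f y|) ^ 2
        ≤ 2 * x ^ (-(1 : ℝ) / 2) * ∫ y in Ioi x, f y ^ 2 := by
    intro x hx
    have hx0 : 0 < x := hX.trans_le hx
    have hρm : AEStronglyMeasurable (fun y : ℝ => y ^ (-(3 : ℝ) / 4)) (volume.restrict (Ioi x)) :=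
      (hρc.mono ((Ioi_subset_Ioi hx).trans Ioi_subset_Ici_self)).aestronglyMeasurable
        measurableSet_Ioi
    have hfm : AEStronglyMeasurable (fun y => |f y|) (volume.restrict (Ioi x)) :=
      ((hf.mono ((Ioi_subset_Ioi hx).trans Ioi_subset_Ici_self)).aestronglyMeasurable
        measurableSet_Ioi).norm
    have hρ2 : IntegrableOn (fun y : ℝ => (y ^ (-(3 : ℝ) / 4)) ^ 2) (Ioi x) := by
      have h := integrableOn_Ioi_rpow_of_lt (by norm_num : (-(3 : ℝ) / 2) < -1) hx0
      refine h.congr_fun (fun y hy => ?_) measurableSet_Ioi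
      exact (rpow_neg_three_quarters_sq (hx0.trans hy)).symm
    have hf2' : IntegrableOn (fun y => |f y| ^ 2) (Ioi x) := by
      simp only [sq_abs]; exact hf2.mono_set (Ioi_subset_Ioi hx)
    refine ⟨?_, ?_⟩
    · have h := integrableOn_mul_of_sq hρm hfm hρ2 hf2'
      exact h
    · have hcs := sq_setIntegral_abs_mul_le hρm hfm hρ2 hf2'
      have habs : ∫ y in Ioi x, abs (y ^ (-(3 : ℝ) / 4) * |f y|)
          = ∫ y in Ioi x, y ^ (-(3 : ℝ) / 4) * |f y| := by
        refine setIntegral_congr_fun measurableSet_Ioi fun y hy => ?_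
        rw [abs_of_nonneg (mul_nonneg (Real.rpow_nonneg (hx0.trans hy).le _) (abs_nonneg _))]
      have hρint : ∫ y in Ioi x, (y ^ (-(3 : ℝ) / 4)) ^ 2 = 2 * x ^ (-(1 : ℝ) / 2) := by
        rw [setIntegral_congr_fun measurableSet_Ioi
          (fun y hy => rpow_neg_three_quarters_sq (hx0.trans hy)),
          integral_Ioi_rpow_of_lt (by norm_num : (-(3 : ℝ) / 2) < -1) hx0]
        rw [show (-(3 : ℝ) / 2 + 1) = -(1 : ℝ) / 2 by norm_num]
        ring
      rw [habs, hρint] at hcs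
      simp only [sq_abs] at hcs
      linarith
  exact ⟨(key X le_rfl).1, fun x hx => (key x hx).2⟩

/-- **Dual Hardy inequality (tail form), part 2.**  Under the hypotheses of `hardy_tail_pointwise`,
with `Φ(x) = ∫_{(x,∞)} y^{-3/4}|f|`: `x^{-1/2} Φ(x)² ∈ L¹(X, ∞)` and
`∫_{(X,∞)} x^{-1/2} Φ² ≤ 16 ∫_{(X,∞)} f²`.  (Integrate `(x^{1/2}Φ²)' = ½ x^{-1/2}Φ² − 2x^{-1/4}Φ|f|`
on `[X, Y]`, bound the cross term by `¼ x^{-1/2}Φ² + 4f²`, and let `Y → ∞` using part 1.) -/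
theorem hardy_tail {f : ℝ → ℝ} {X : ℝ} (hX : 0 < X) (hf : ContinuousOn f (Ici X))
    (hf2 : IntegrableOn (fun x => f x ^ 2) (Ioi X)) :
    IntegrableOn (fun x => x ^ (-(1 : ℝ) / 2) * (∫ y in Ioi x, y ^ (-(3 : ℝ) / 4) * |f y|) ^ 2) (Ioi X) ∧
      ∫ x in Ioi X, x ^ (-(1 : ℝ) / 2) * (∫ y in Ioi x, y ^ (-(3 : ℝ) / 4) * |f y|) ^ 2
        ≤ 16 * ∫ x in Ioi X, f x ^ 2 := by
  obtain ⟨hL1, hpt⟩ := hardy_tail_pointwise hX hf hf2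
  set ρ : ℝ → ℝ := fun y => y ^ (-(3 : ℝ) / 4) with hρ
  set Φ : ℝ → ℝ := fun x => ∫ y in Ioi x, ρ y * |f y| with hΦ
  set B : ℝ := ∫ x in Ioi X, f x ^ 2 with hB
  have hB0 : 0 ≤ B := integral_nonneg fun x => sq_nonneg _
  have hρfc : ContinuousOn (fun y => ρ y * |f y|) (Ici X) := by
    refine ContinuousOn.mul (fun y hy => ?_) hf.norm
    exact (Real.continuousAt_rpow_const _ _ (Or.inl (hX.trans_le hy).ne')).continuousWithinAt
  -- continuity and derivative of `Φ`
  have hΦc : ContinuousOn Φ (Ici X) := by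
    have h := Literature.Analysis.ODE.continuous_integral_Ioi_max hρfc hL1
    refine (h.continuousOn (s := Ici X)).congr fun x hx => ?_
    simp only [hΦ, max_eq_left (show X ≤ x from hx)]
  have hΦd : ∀ x, X < x → HasDerivAt Φ (-(ρ x * |f x|)) x := fun x hx =>
    Literature.Analysis.ODE.hasDerivAt_integral_Ioi hρfc hL1 hx
  have hΦ0 : ∀ x, X ≤ x → 0 ≤ Φ x := fun x hx =>
    setIntegral_nonneg measurableSet_Ioi fun y hy =>
      mul_nonneg (Real.rpow_nonneg ((hX.trans_le hx).trans hy).le _) (abs_nonneg _)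
  -- tails of `∫ f²`
  have htailB : ∀ x, X ≤ x → ∫ y in Ioi x, f y ^ 2 ≤ B := fun x hx =>
    setIntegral_mono_set hf2 (ae_of_all _ fun y => sq_nonneg _) (ae_of_all _ (Ioi_subset_Ioi hx))
  -- `h(x) = x^{1/2} Φ²` and its derivative on `(X, ∞)`
  set h : ℝ → ℝ := fun x => x ^ ((1 : ℝ) / 2) * Φ x ^ 2 with hh
  have hhd : ∀ x, X < x → HasDerivAt h
      ((1 / 2) * (x ^ (-(1 : ℝ) / 2) * Φ x ^ 2) - 2 * (x ^ (-(1 : ℝ) / 4) * Φ x * |f x|)) x := by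
    intro x hx
    have hx0 : 0 < x := hX.trans hx
    have h1 : HasDerivAt (fun x : ℝ => x ^ ((1 : ℝ) / 2)) ((1 : ℝ) / 2 * x ^ ((1 : ℝ) / 2 - 1)) x :=
      Real.hasDerivAt_rpow_const (Or.inl hx0.ne')
    have h2 : HasDerivAt (fun x => Φ x ^ 2) (↑2 * Φ x ^ (2 - 1) * (-(ρ x * |f x|))) x :=
      (hΦd x hx).pow 2
    have h12 := h1.mul h2
    refine h12.congr_deriv ?_
    have e1 : x ^ ((1 : ℝ) / 2 - 1) = x ^ (-(1 : ℝ) / 2) := by norm_num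
    have e2 : x ^ ((1 : ℝ) / 2) * ρ x = x ^ (-(1 : ℝ) / 4) := rpow_half_mul_rpow_neg_three_quarters hx0
    rw [e1]
    simp only [Nat.add_one_sub_one, pow_one]
    have : x ^ ((1 : ℝ) / 2) * (2 * Φ x * -(ρ x * |f x|)) = -2 * ((x ^ ((1 : ℝ) / 2) * ρ x) * Φ x * |f x|) := by
      ring
    rw [this, e2]
    ring
  -- the bound `h(Y) ≤ 2 ∫_{(Y,∞)} f²`
  have hhY : ∀ Y, X ≤ Y → h Y ≤ 2 * ∫ y in Ioi Y, f y ^ 2 := by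
    intro Y hY
    have hY0 : 0 < Y := hX.trans_le hY
    have hp := hpt Y hY
    have hmul := mul_le_mul_of_nonneg_left hp (Real.rpow_nonneg hY0.le ((1 : ℝ) / 2))
    calc h Y = Y ^ ((1 : ℝ) / 2) * Φ Y ^ 2 := rfl
      _ ≤ Y ^ ((1 : ℝ) / 2) * (2 * Y ^ (-(1 : ℝ) / 2) * ∫ y in Ioi Y, f y ^ 2) := hmul
      _ = 2 * (Y ^ ((1 : ℝ) / 2) * Y ^ (-(1 : ℝ) / 2)) * ∫ y in Ioi Y, f y ^ 2 := by ring
      _ = 2 * ∫ y in Ioi Y, f y ^ 2 := by rw [rpow_half_mul_rpow_neg_half hY0, mul_one]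
  -- the interval bound `∫_X^Y x^{-1/2}Φ² ≤ 4 h(Y) + 16 B ≤ 24 B`
  set e : ℝ → ℝ := fun x => x ^ (-(1 : ℝ) / 2) * Φ x ^ 2 with he
  have hec : ContinuousOn e (Ici X) := by
    refine ContinuousOn.mul (fun x hx => ?_) (hΦc.pow 2)
    exact (Real.continuousAt_rpow_const _ _ (Or.inl (hX.trans_le hx).ne')).continuousWithinAt
  have he0 : ∀ x, X ≤ x → 0 ≤ e x := fun x hx =>
    mul_nonneg (Real.rpow_nonneg (hX.trans_le hx).le _) (sq_nonneg _)
  have hcross_c : ContinuousOn (fun x => x ^ (-(1 : ℝ) / 4) * Φ x * |f x|) (Ici X) := by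
    refine ContinuousOn.mul (ContinuousOn.mul (fun x hx => ?_) hΦc) hf.norm
    exact (Real.continuousAt_rpow_const _ _ (Or.inl (hX.trans_le hx).ne')).continuousWithinAt
  have hint : ∀ Y, X ≤ Y → ∫ x in X..Y, e x ≤ 4 * h Y + 16 * B := by
    intro Y hY
    have hcI : ContinuousOn h (Icc X Y) := by
      refine ContinuousOn.mul (fun x hx => ?_) ((hΦc.mono Icc_subset_Ici_self).pow 2)
      exact (Real.continuousAt_rpow_const _ _ (Or.inl (hX.trans_le hx.1).ne')).continuousWithinAt
    have hderiv_c : ContinuousOn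
        (fun x => (1 / 2) * (x ^ (-(1 : ℝ) / 2) * Φ x ^ 2) - 2 * (x ^ (-(1 : ℝ) / 4) * Φ x * |f x|))
        (Icc X Y) :=
      ((hec.mono Icc_subset_Ici_self).const_smul (1 / 2 : ℝ)).sub
        ((hcross_c.mono Icc_subset_Ici_self).const_smul (2 : ℝ))
    have hftc := intervalIntegral.integral_eq_sub_of_hasDeriv_right_of_le hY hcI
      (fun x hx => (hhd x hx.1).hasDerivWithinAt) (hderiv_c.intervalIntegrable_of_Icc hY)
    -- split the integral of the derivative
    have hi1 : IntervalIntegrable (fun x => (1 / 2) * (x ^ (-(1 : ℝ) / 2) * Φ x ^ 2)) volume X Y :=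
      ((hec.mono Icc_subset_Ici_self).const_smul (1 / 2 : ℝ)).intervalIntegrable_of_Icc hY
    have hi2 : IntervalIntegrable (fun x => 2 * (x ^ (-(1 : ℝ) / 4) * Φ x * |f x|)) volume X Y :=
      ((hcross_c.mono Icc_subset_Ici_self).const_smul (2 : ℝ)).intervalIntegrable_of_Icc hY
    rw [intervalIntegral.integral_sub hi1 hi2, intervalIntegral.integral_const_mul] at hftc
    -- the cross term: `2 x^{-1/4} Φ |f| ≤ ¼ x^{-1/2} Φ² + 4 f²` pointwise
    have hcross : ∫ x in X..Y, 2 * (x ^ (-(1 : ℝ) / 4) * Φ x * |f x|)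
        ≤ ∫ x in X..Y, ((1 / 4) * e x + 4 * f x ^ 2) := by
      refine intervalIntegral.integral_mono_on hY hi2 ?_ fun x hx => ?_
      · exact (((hec.mono Icc_subset_Ici_self).const_smul (1 / 4 : ℝ)).add
          (((hf.mono Icc_subset_Ici_self).pow 2).const_smul (4 : ℝ))).intervalIntegrable_of_Icc hY
      · have hx0 : 0 < x := hX.trans_le hx.1
        have hsq : (x ^ (-(1 : ℝ) / 4) * Φ x) ^ 2 = e x := by
          simp only [he, mul_pow, rpow_neg_quarter_sq hx0]
        nlinarith [sq_nonneg (x ^ (-(1 : ℝ) / 4) * Φ x / 2 - 2 * |f x|), sq_abs (f x)]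
    have hf2I : ∫ x in X..Y, f x ^ 2 ≤ B := by
      rw [intervalIntegral.integral_of_le hY]
      exact setIntegral_mono_set hf2 (ae_of_all _ fun x => sq_nonneg _)
        (ae_of_all _ Ioc_subset_Ioi_self)
    have hsplit : ∫ x in X..Y, ((1 / 4) * e x + 4 * f x ^ 2)
        = (1 / 4) * (∫ x in X..Y, e x) + 4 * ∫ x in X..Y, f x ^ 2 := by
      rw [intervalIntegral.integral_add, intervalIntegral.integral_const_mul,
        intervalIntegral.integral_const_mul]
      · exact ((hec.mono Icc_subset_Ici_self).const_smul (1 / 4 : ℝ)).intervalIntegrable_of_Icc hY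
      · exact (((hf.mono Icc_subset_Ici_self).pow 2).const_smul (4 : ℝ)).intervalIntegrable_of_Icc hY
    have hhX : 0 ≤ h X := mul_nonneg (Real.rpow_nonneg hX.le _) (sq_nonneg _)
    rw [hsplit] at hcross
    have heq : ∫ x in X..Y, x ^ (-(1 : ℝ) / 2) * Φ x ^ 2 = ∫ x in X..Y, e x := rfl
    rw [heq] at hftc
    linarith
  -- integrability on `(X, ∞)` from the uniform bound `24 B`
  have hI : IntegrableOn e (Ioi X) := by
    refine integrableOn_Ioi_of_intervalIntegral_norm_bounded (24 * B) X
      (l := atTop) (b := id) (fun Y => ?_) tendsto_id ?_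
    · exact ((hec.mono Icc_subset_Ici_self).integrableOn_compact isCompact_Icc).mono_set
        Ioc_subset_Icc_self
    · filter_upwards [Filter.eventually_ge_atTop X] with Y hY
      have : ∫ x in X..id Y, ‖e x‖ = ∫ x in X..Y, e x :=
        intervalIntegral.integral_congr fun x hx => by
          have hx' : x ∈ uIcc X Y := hx
          rw [uIcc_of_le hY] at hx'
          rw [Real.norm_eq_abs, abs_of_nonneg (he0 x hx'.1)]
      rw [this]
      linarith [hint Y hY, hhY Y hY, htailB Y hY]
  refine ⟨hI, ?_⟩
  -- pass to the limit `Y → ∞`: `∫_X^Y e → ∫_{(X,∞)} e` and `4 h(Y) + 16 B → 16 B`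
  have hlim := intervalIntegral_tendsto_integral_Ioi X hI tendsto_id
  have htail0 : Tendsto (fun Y => ∫ y in Ioi Y, f y ^ 2) atTop (𝓝 0) :=
    Literature.Analysis.Calculus.tendsto_setIntegral_Ioi_tail hf2
  have hupper : Tendsto (fun Y => 4 * (2 * ∫ y in Ioi Y, f y ^ 2) + 16 * B) atTop (𝓝 (16 * B)) := by
    have := (htail0.const_mul 2).const_mul 4 |>.add_const (16 * B)
    simpa using this
  refine le_of_tendsto_of_tendsto hlim hupper ?_
  filter_upwards [Filter.eventually_ge_atTop X] with Y hY
  have h1 := hint Y hY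
  have h2 := hhY Y hY
  simp only [id]
  linarith

/-- Registered sub-goal `peel_hardyTail` of `stub_peel` (verbatim signature): the dual Hardy
inequality `∫_X^∞ x^{-1/2} (∫_x^∞ y^{-3/4}|f|)² ≤ 16 ∫_X^∞ f²` with its integrability clause. -/
theorem peel_hardyTail : ∀ (f : ℝ → ℝ) (X : ℝ), 0 < X → ContinuousOn f (Set.Ici X) →
    MeasureTheory.IntegrableOn (fun x => f x ^ 2) (Set.Ioi X) →
    MeasureTheory.IntegrableOn (fun x => x ^ (-(1 : ℝ) / 2) *
        (MeasureTheory.integral (MeasureTheory.volume.restrict (Set.Ioi x))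
          (fun y => y ^ (-(3 : ℝ) / 4) * |f y|)) ^ 2) (Set.Ioi X) ∧
      MeasureTheory.integral (MeasureTheory.volume.restrict (Set.Ioi X))
          (fun x => x ^ (-(1 : ℝ) / 2) *
            (MeasureTheory.integral (MeasureTheory.volume.restrict (Set.Ioi x))
              (fun y => y ^ (-(3 : ℝ) / 4) * |f y|)) ^ 2)
        ≤ 16 * MeasureTheory.integral (MeasureTheory.volume.restrict (Set.Ioi X))
          (fun x => f x ^ 2) :=
  fun _ _ hX hf hf2 => hardy_tail hX hf hf2

end Summit.FinalStateConjecture.FinalStateConjecture.Theorems.CrumPeelingRecessiveTower
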